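import Summits.QuantumFields.BalabanUV.T4Continuum.Support.B13AvgCorrKappaOneBelow
import Summits.QuantumFields.BalabanUV.T4Continuum.Support.B13AvgCorrStokesVariationLoop
import Summits.QuantumFields.BalabanUV.T4Continuum.Support.B13AvgCorrEmlVariation

/-!
# B13AvgCorrKappaOne — row NE5, J-avg-reg SECOND ORDER (T4-DAG §8 Q52 (2) «σ-END»; memo `t4/T4-EST-NE5-JAVG-SECOND.md` (C1), module P1-c of its §4),
# σ-END: THE ONE-STEP CORRECTION FACTORS OF BAŁABAN's (0.4) AVERAGE OF RECORD ARE LIPSCHITZ UNDER UNIT BLOCK SHIFTS AT SCALE `ℓ⁻³`, WITH AN EXPLICIT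
# `κ₁ = kappaOne d α β β₂ δ_N`, UNDER `6(d+2) ≤ L` AND NO SMALLNESS CONDITION

Cell `pub-balaban`, unit `b2b-balaban-t4-ne5-formalise-leaf-09` (NE5 formalisation swarm LEAF PROVER 09, gen 20; σ-END CLAIM `HOME/CLAIMS.log` l.25204,
first refusal answered «GO — NOT MINE; THIS SHAPE» by the κ-END lineage l.25293, σ-L4 sockets note by leaf-06-g22 l.25315 (the THRESHOLD-FREE socket
`B13AvgCorrEmlVariation.dist1_corr_mul_inv_le_add` is the one used: the guard-jump term `3κ₀²∕δ_N`, quadratic in the κ chain's loop budget, joins `κ₁`)).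
Summits-side NEW WORK under the LEAN PLACEMENT RULE; [folklore] composition + real arithmetic; 0 `def` here (the constant lives in PART 2a); no
`Prop`-valued fact minted; no citation tag.

HONEST FRAMING: rung (B)+1 of the FINITE-VOLUME T⁴ programme — NOT infinite volume, NOT a mass gap, NOT the Clay problem, NOT a proof of NE5 (NOT PRINTED;
GAPS G-t4-U3-1).  [folklore] estimates on OUR objects (`expMeanLogSU`, `avgTower`, `corr`, `corrAcc`, `holAt`, `loopWord`, `GaugeField.translate`); nothing of
[Balaban1985Averaging] Props 5–10 ∕ [Balaban1985BackgroundPropagators] (3.35)–(3.36) ∕ [Balaban1987RG1] (0.4)–(0.7) is asserted, reproduced or certified —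
the window letters (α, β, β₂) are DISPLAYED hypotheses, discharged by nobody here.  HONEST DEPENDENCY (cell line, verbatim): continuum YM on T⁴ ⇐ BetaPertH ∧
nine spine estimates (0/9 proved); BetaPertH ⇐ (D1) ∧ (D4) ∧ CAP+tail; G-an2-4 gates asym, D1 and NE2/3/4.

THE ROAD (memo (S4)∕(S5); the κ-END road one lattice difference up).  Fix `i < K`, a level-`(i+1)` bond `c` and a direction `ν`.  The block shift
`c ↦ c + e_ν` is the finest translation `τ` by `scaleTo (i+1) e_ν = L^(i+1) • e_ν` (PART 1 `corr_avgTower_translate`), so the one-step quotient reads in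
TWO FIELDS `V′ = V ∘ τ`, `V` — σ-L3's currency.  σ-L4 (`dist1_corr_mul_inv_le_add`, leaf-06) bounds it by `9∕4·δ + 3ρ²∕δ_N` from the loop quotients `δ`
and the loop budgets `ρ = κ∕ℓ²` of BOTH families (the κ chain's, re-derived in §1 — `V′` is in the window too); σ-L3's two-field END
(`dist1_loopHol_avgTower_quot_le_of_forall`, leaf-03) splits `δ` into `(d+2)L·tC + (L^i t₀)·a·(…) +` the finest refined-loop quotient; the latter is
σ-L1 file 2's Stokes for differences (`dist1_two_loopWord_le_of_bound`, leaf-10) on κ-L3's refined word with EVERY letter produced from the window by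
PART 1 (`hs` by leaf-07's Window, `hs₁` by the telescoped σ-L2-on-`GaugeField` plaquette variation, `ht`, `hcomm`); `a` is κ-END's accumulated budget
(leaf-04), `tC` is PART 2a's accumulated-quotient induction fed by the one-step letters BELOW `i`; PART 2a's `step_le` closes the step with the
self-consistent `κ₁`; strong induction on `i` (`Nat.strong_induction_on`, the `kappa_induction` shape of the substrate's PART 1b with quotient budgets).

WHAT.  §1 `dist1_loopHol_avgTower_le_window` (the κ chain's LOOP budget `κ∕(L^(K−1−i))²`, `κ = 3(d∕2 + d²∕8)(2β + 2α²)`), **`dist1_corr_shift_quot_le_of_loopHol`**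
(σ-L4 at the translate instance), `length_refined_loopWord_le`, `area_le`, `refined_h_le`, **`dist1_loopHol_shift_quot_le_of_letters`** (the loop quotient of
step `i` from the letters, `tC` displayed); §3 **`sigma_step`** (the unit-shift letter at level `i` from the letters below `i`); §4 the END
**`dist1_corr_avgTower_shift_quot_le`** `: (hι) (hdist) (hL6 : 6·(P.d+2) ≤ P.L) (V) (hβ : 0 ≤ β) (hβ₂ : 0 ≤ β₂) (hsize) (hlip) (hsec) :
∀ i < P.K, ∀ c ν, dist1 (corr expMeanLogSU (avgTower expMeanLogSU V i) (c.translate ((0 : Site P (i+1)).shift ν)) · (corr … c)⁻¹)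
≤ kappaOne P.d α β β₂ (deltaSU n) ∕ ((P.L:ℝ)^(P.K−1−i))^3`, its matrix-difference currency **`norm_corr_avgTower_shift_sub_le`** (the memo's (C1) display ∕
the owner's abstract half `B13ReadingsAvgTowerSecond.dist_shift_of_step`'s `hCC : ‖C′ − C‖ ≤ κ₁∕ℓ³`) and its k-INDEXED scaled currency
**`norm_corr_avgTower_shift_sub_scaled_le`** (`i + 1 + k = K ⟹ ‖ι corr′ − ι corr‖·(lev L k)³ ≤ κ₁` — the substrate's W-28b letters live in it) and
**`dist1_corr_avgTower_shift_quot_scaled_le`** = the substrate's J-σ₁ display (W-28c `corr_shift_clause`'s `hκ₁` binder, token for token: shifted bond `⟨x + e_ν, μ⟩`,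
dist1-quotient, `(lev L k)³`-scaled).
0 sorry; axioms ⊆ {propext, Classical.choice, Quot.sound}.
-/

noncomputable section

open scoped BigOperators Matrix Matrix.Norms.L2Operator

namespace Summit.QuantumFields.BalabanUV.T4Continuum.B13AvgCorrKappaOne

open Literature.MathematicalPhysics.QuantumFieldTheory.Balaban1983to89
open Literature.MathematicalPhysics.QuantumFieldTheory.Balaban1983to89.T4Continuum (walk holAt loopWord walkEnd)
open Literature.MathematicalPhysics.QuantumFieldTheory.Balaban1983to89.BlockAveraging (Idx off off_bounds loopHol corr)
open Literature.MathematicalPhysics.QuantumFieldTheory.Balaban1983to89.ExpMeanLog (expMeanLogSU deltaSU deltaSU_pos)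
open Summit.QuantumFields.BalabanUV.T4Continuum.SubstrateAvgTowerStructure (avgTower axialTower corrAcc)
open Summit.QuantumFields.BalabanUV.T4Continuum.B13AvgCorrKappaOneLetters
open Literature.MathematicalPhysics.QuantumFieldTheory.Balaban1983to89.B5G183RateUnitTower (lev)
open Summit.QuantumFields.BalabanUV.T4Continuum.BalabanAveragedTowerUnit (cast_lev' one_le_lev')


open Summit.QuantumFields.BalabanUV.T4Continuum.B13AvgCorrKappaOneBelow

/-! ## §1 The loop budget of the κ chain (re-derived as inside κ-END) and the one-step quotient from LOCAL letters -/

section Local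

variable {P : Params} {n : Type*} [Fintype n] [DecidableEq n] [Nonempty n] {o : Type*} [Fintype o] [DecidableEq o]
  (ι : Matrix.specialUnitaryGroup n ℂ →* Matrix o o ℂ)

/-- [folklore] **THE LOOP BUDGET OF THE κ CHAIN**: in the two-letter window and under `6(d+2) ≤ L`, every (0.4) loop variable of the level-`i` averaged field
is within `κ∕(L^(K−1−i))²` of `1`, `κ := 3(d∕2 + d²∕8)(2β + 2α²)` (κ-L3 ∘ κ-END §2 ∘ Window, then κ-END's `step_arith`; κ-END's own proof has this one line
before κ-L4 — re-derived here since κ-END exports the correction bound only). -/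
theorem dist1_loopHol_avgTower_le_window (hι : ∀ g, ι g ∈ Matrix.unitaryGroup o ℂ) (hdist : ∀ g, ‖ι g - 1‖ = dist1 g)
    (hL6 : 6 * (P.d + 2) ≤ P.L) (V : GaugeField P 0 (Matrix.specialUnitaryGroup n ℂ)) {α β : ℝ} (hβ : 0 ≤ β)
    (hsize : ∀ b : PBond P 0, (P.L : ℝ) ^ P.K * dist1 (V b) ≤ α)
    (hlip : ∀ (x : Site P 0) (ν μ : Fin P.d), (P.L : ℝ) ^ P.K * ‖ι (V ⟨x.shift μ, ν⟩) - ι (V ⟨x, ν⟩)‖ ≤ β / (P.L : ℝ) ^ P.K)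
    {i : ℕ} (hi : i < P.K) (c : PBond P (i + 1)) (r : Idx P) :
    dist1 (loopHol (avgTower (expMeanLogSU (n := n)) V i) c r)
      ≤ 3 * (((P.d : ℝ) / 2 + (P.d : ℝ) ^ 2 / 8) * (2 * β + 2 * α ^ 2)) / ((P.L : ℝ) ^ (P.K - 1 - i)) ^ 2 := by
  have ha := fun b => B13AvgCorrKappa.dist1_corrAcc_avgTower_le ι hι hdist hL6 V hβ hsize hlip (j := i) hi.le b
  have h1 := (B13AvgCorrRefine.dist1_loopHol_avgTower_le_of_forall (expMeanLogSU (n := n)) V i ha c r).trans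
    (add_le_add le_rfl (B13AvgCorrKappa.dist1_holAt_refined_loopWord_le V (by positivity)
      (fun p => B13AvgCorrPlaquetteWindow.dist1_plaqHol_le_of_window ι hι hdist V hsize hlip p) i c r))
  have h2 := B13AvgCorrKappa.step_arith (P := P) hL6 hβ (α := α) hi
  have h0 : 0 ≤ dist1 (loopHol (avgTower (expMeanLogSU (n := n)) V i) c r) := GaugeGroup.dist1_nonneg _
  linarith

/-- [folklore] **THE ONE-STEP QUOTIENT FROM THE LOOP QUOTIENTS** (σ-L4's threshold-free socket `dist1_corr_mul_inv_le_add` at the translate instance):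
if the (0.4) loop variables of `U_i(V ∘ τ)` and `U_i(V)` at `c` are `δ`-close, `τ` the finest translation of the block shift `c ↦ c + a`, then
`dist1 (corr ℰ U_i (c + a) · (corr ℰ U_i c)⁻¹) ≤ 9∕4·δ + 3(κ∕ℓ²)²∕δ_N`, `ℓ = L^(K−1−i)` — NO smallness condition (the guard-jump term is quadratic in the
first-order data). -/
theorem dist1_corr_shift_quot_le_of_loopHol (hι : ∀ g, ι g ∈ Matrix.unitaryGroup o ℂ) (hdist : ∀ g, ‖ι g - 1‖ = dist1 g)
    (hL6 : 6 * (P.d + 2) ≤ P.L) (V : GaugeField P 0 (Matrix.specialUnitaryGroup n ℂ)) {α β : ℝ} (hβ : 0 ≤ β)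
    (hsize : ∀ b : PBond P 0, (P.L : ℝ) ^ P.K * dist1 (V b) ≤ α)
    (hlip : ∀ (x : Site P 0) (ν μ : Fin P.d), (P.L : ℝ) ^ P.K * ‖ι (V ⟨x.shift μ, ν⟩) - ι (V ⟨x, ν⟩)‖ ≤ β / (P.L : ℝ) ^ P.K)
    {i : ℕ} (hi : i < P.K) (c : PBond P (i + 1)) (a : Site P (i + 1)) {δ : ℝ}
    (hq : ∀ r, dist1 (loopHol (avgTower (expMeanLogSU (n := n)) (V.translate (Site.scaleTo (i + 1) a)) i) c r
      * (loopHol (avgTower (expMeanLogSU (n := n)) V i) c r)⁻¹) ≤ δ) :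
    dist1 (corr (expMeanLogSU (n := n)) (avgTower (expMeanLogSU (n := n)) V i) (c.translate a)
        * (corr (expMeanLogSU (n := n)) (avgTower (expMeanLogSU (n := n)) V i) c)⁻¹)
      ≤ 9 / 4 * δ + 3 * (3 * (((P.d : ℝ) / 2 + (P.d : ℝ) ^ 2 / 8) * (2 * β + 2 * α ^ 2)) / ((P.L : ℝ) ^ (P.K - 1 - i)) ^ 2) ^ 2
          / deltaSU n := by
  rw [← corr_avgTower_translate]
  exact B13AvgCorrEmlVariation.dist1_corr_mul_inv_le_add _ c _ c
    (fun r => dist1_loopHol_avgTower_le_window ι hι hdist hL6 V hβ hsize hlip hi c r)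
    (fun r => dist1_loopHol_avgTower_le_window ι hι hdist hL6 (V.translate _) hβ (hsize_translate V hsize _) (hlip_translate ι V hlip _) hi c r)
    hq

/-- [folklore] the refined (0.4) loop word of step `i` (κ-L3's END word) has `≤ (d+2)·L^(i+1)` letters (κ-L3 `refineWord_loopWord` + `length_refineWord` +
`length_loopWord_off_le`). -/
theorem length_refined_loopWord_le {P : Params} (i : ℕ) (μ : Fin P.d) (r : Idx P) :
    (loopWord (P.L ^ (i + 1)) μ (fun ν => ((P.L : ℤ) ^ i) * off r.1 ν) r.2.1 r.2.2).length ≤ (P.d + 2) * P.L ^ (i + 1) := by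
  have e : loopWord (P.L ^ (i + 1)) μ (fun ν => ((P.L : ℤ) ^ i) * off r.1 ν) r.2.1 r.2.2
      = B13AvgCorrRefine.refineWord (P.L ^ i) (loopWord P.L μ (off r.1) r.2.1 r.2.2) := by
    rw [B13AvgCorrRefine.refineWord_loopWord, ← pow_succ]; push_cast; rfl
  rw [e, B13AvgCorrRefine.length_refineWord, pow_succ]
  calc (loopWord P.L μ (off r.1) r.2.1 r.2.2).length * P.L ^ i ≤ ((P.d + 2) * P.L) * P.L ^ i :=
        Nat.mul_le_mul_right _ (B13AvgCorrRefine.length_loopWord_off_le μ r.1 r.2.1 r.2.2)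
    _ = (P.d + 2) * (P.L ^ i * P.L) := by ring

/-- [folklore] the area factor of the Stokes bounds at the refined offsets: `X·d·h + (d·h)²∕2 ≤ (d∕2 + d²∕8)·X²` for `h ≤ X∕2` (κ-END `second_term_scale`'s key). -/
theorem area_le {d X h : ℝ} (hd : 0 ≤ d) (hh0 : 0 ≤ h) (hX : 0 ≤ X) (hh : h ≤ X / 2) :
    X * (d * h) + (d * h) ^ 2 / 2 ≤ (d / 2 + d ^ 2 / 8) * X ^ 2 := by
  have hdh : d * h ≤ d * (X / 2) := mul_le_mul_of_nonneg_left hh hd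
  have hdh0 : 0 ≤ d * h := mul_nonneg hd hh0
  have hsq : (d * h) ^ 2 ≤ (d * (X / 2)) ^ 2 := pow_le_pow_left₀ hdh0 hdh 2
  nlinarith [mul_le_mul_of_nonneg_left hdh hX]

/-- [folklore] the refined offsets satisfy `L^i·((L−1)∕2) ≤ L^(i+1)∕2` (cast form). -/
theorem refined_h_le {P : Params} (i : ℕ) : (((P.L ^ i * ((P.L - 1) / 2) : ℕ) : ℝ)) ≤ ((P.L ^ (i + 1) : ℕ) : ℝ) / 2 := by
  have hhalf : (2 : ℝ) * (((P.L - 1) / 2 : ℕ) : ℝ) ≤ P.L := by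
    have : 2 * ((P.L - 1) / 2) ≤ P.L := by omega
    exact_mod_cast this
  rw [Nat.cast_mul, Nat.cast_pow, Nat.cast_pow, pow_succ, le_div_iff₀ (by norm_num : (0:ℝ) < 2)]
  have h0 : (0 : ℝ) ≤ (P.L : ℝ) ^ i := by positivity
  nlinarith [mul_le_mul_of_nonneg_left hhalf h0]

/-- [folklore] **THE LOOP QUOTIENT OF STEP `i` FROM THE LETTERS** — σ-L3's two-field END `dist1_loopHol_avgTower_quot_le_of_forall` at the translate pair
`(V ∘ τ_{L^(i+1) e_ν}, V)` with: the accumulated budget `a := 2κ∕(L^(K−i))²` of κ-END, the displayed accumulated-quotient letter `tC` (produced below by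
the induction), the straight-tower quotient `L^i·t₀` (σ-L3 `dist1_axialTower_quot_le`, `t₀ := L^(i+1)·β∕(L^K)²` by PART 1's telescoped bond letter), and
σ-L1 file 2's Stokes-for-differences END on the refined loop word (letters: κ-L1's `hs` by Window, `hs₁` by PART 1's telescoped plaquette variation, `ht`,
`hcomm` by PART 1 §1), the area bounded by `(d∕2 + d²∕8)·(L^(i+1))²`. -/
theorem dist1_loopHol_shift_quot_le_of_letters (hι : ∀ g, ι g ∈ Matrix.unitaryGroup o ℂ) (hdist : ∀ g, ‖ι g - 1‖ = dist1 g)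
    (hL6 : 6 * (P.d + 2) ≤ P.L) (V : GaugeField P 0 (Matrix.specialUnitaryGroup n ℂ)) {α β β₂ : ℝ} (hβ : 0 ≤ β) (hβ₂ : 0 ≤ β₂)
    (hsize : ∀ b : PBond P 0, (P.L : ℝ) ^ P.K * dist1 (V b) ≤ α)
    (hlip : ∀ (x : Site P 0) (ν μ : Fin P.d), (P.L : ℝ) ^ P.K * ‖ι (V ⟨x.shift μ, ν⟩) - ι (V ⟨x, ν⟩)‖ ≤ β / (P.L : ℝ) ^ P.K)
    (hsec : ∀ (x : Site P 0) (μ ν ρ : Fin P.d), (P.L : ℝ) ^ P.K *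
      ‖ι (V ⟨(x.shift ν).shift ρ, μ⟩) - ι (V ⟨x.shift ν, μ⟩) - ι (V ⟨x.shift ρ, μ⟩) + ι (V ⟨x, μ⟩)‖ ≤ β₂ / ((P.L : ℝ) ^ P.K) ^ 2)
    {i : ℕ} (hi : i < P.K) (c : PBond P (i + 1)) (ν : Fin P.d) {tC : ℝ}
    (hC : ∀ b : PBond P i, dist1 (corrAcc (expMeanLogSU (n := n)) (V.translate (Site.scaleTo (i + 1) ((0 : Site P (i + 1)).shift ν))) i b
      * (corrAcc (expMeanLogSU (n := n)) V i b)⁻¹) ≤ tC) (r : Idx P) :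
    dist1 (loopHol (avgTower (expMeanLogSU (n := n)) (V.translate (Site.scaleTo (i + 1) ((0 : Site P (i + 1)).shift ν))) i) c r
        * (loopHol (avgTower (expMeanLogSU (n := n)) V i) c r)⁻¹)
      ≤ (((P.d + 2) * P.L : ℕ) : ℝ) * tC
        + ((P.L : ℝ) ^ i * (((P.L ^ (i + 1) : ℕ) : ℝ) * (β / ((P.L : ℝ) ^ P.K) ^ 2)))
          * (2 * (3 * (((P.d : ℝ) / 2 + (P.d : ℝ) ^ 2 / 8) * (2 * β + 2 * α ^ 2))) / ((P.L : ℝ) ^ (P.K - i)) ^ 2)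
          * ((((P.d + 2) * P.L : ℕ) : ℝ) * (((P.d + 2) * P.L : ℕ) + 1))
        + ((P.d : ℝ) / 2 + (P.d : ℝ) ^ 2 / 8) * (((P.L ^ (i + 1) : ℕ) : ℝ)) ^ 2
          * (((P.L ^ (i + 1) : ℕ) : ℝ) * ((2 * β₂ + 4 * α * β) / ((P.L : ℝ) ^ P.K) ^ 3 + 2 * β * (2 * β + 2 * α ^ 2) / ((P.L : ℝ) ^ P.K) ^ 4)
            + 2 * ((2 * β + 2 * α ^ 2) / (P.L : ℝ) ^ (2 * P.K)) * (((P.L ^ (i + 1) : ℕ) : ℝ) * (β / ((P.L : ℝ) ^ P.K) ^ 2))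
              * ((((P.d + 2) * P.L ^ (i + 1) : ℕ) : ℝ) + 2)) := by
  -- the translate, read as `L^(i+1)` unit steps on the finest lattice
  have hT : Site.scaleTo (i + 1) ((0 : Site P (i + 1)).shift ν) = P.L ^ (i + 1) • (0 : Site P 0).shift ν := scaleTo_zero_shift (i + 1) ν
  set V' : GaugeField P 0 (Matrix.specialUnitaryGroup n ℂ) := V.translate (Site.scaleTo (i + 1) ((0 : Site P (i + 1)).shift ν)) with hV'
  have hV'eq : V' = V.translate (P.L ^ (i + 1) • (0 : Site P 0).shift ν) := by rw [hV', hT]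
  have hL0 : (0 : ℝ) < P.L := by exact_mod_cast P.L_pos
  have hX : (0 : ℝ) < (P.L : ℝ) ^ P.K := pow_pos hL0 _
  -- letters
  have hcomm := dist1_commutator_le ι hι hdist
  have ht0 : (0 : ℝ) ≤ ((P.L ^ (i + 1) : ℕ) : ℝ) * (β / ((P.L : ℝ) ^ P.K) ^ 2) := by positivity
  have ht : ∀ b : PBond P 0, dist1 (V' b * (V b)⁻¹) ≤ ((P.L ^ (i + 1) : ℕ) : ℝ) * (β / ((P.L : ℝ) ^ P.K) ^ 2) := fun b => by
    rw [hV'eq]; exact dist1_translate_nsmul_quot_le ι hι hdist V hlip ν (P.L ^ (i + 1)) b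
  have hs0 : (0 : ℝ) ≤ (2 * β + 2 * α ^ 2) / (P.L : ℝ) ^ (2 * P.K) := by positivity
  have hs := B13AvgCorrStokes.plaq_pair_bound_of_plaqHol V (fun p => B13AvgCorrPlaquetteWindow.dist1_plaqHol_le_of_window ι hι hdist V hsize hlip p)
  have hα : 0 ≤ α := le_trans (mul_nonneg hX.le (GaugeGroup.dist1_nonneg _)) (hsize ⟨default, ⟨0, P.hd⟩⟩)
  have hs₁0 : (0 : ℝ) ≤ ((P.L ^ (i + 1) : ℕ) : ℝ) * ((2 * β₂ + 4 * α * β) / ((P.L : ℝ) ^ P.K) ^ 3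
      + 2 * β * (2 * β + 2 * α ^ 2) / ((P.L : ℝ) ^ P.K) ^ 4) := by positivity
  have hs₁ := B13AvgCorrStokesVariation.plaq_pair_diff_bound_of_plaqHol V V' (fun p => by
    rw [hV'eq]; exact dist1_plaqHol_translate_nsmul_quot_le ι hι hdist V hsize hlip hsec ν (P.L ^ (i + 1)) p)
  -- σ-L3's END with the accumulated letters
  have ha := fun b => B13AvgCorrKappa.dist1_corrAcc_avgTower_le ι hι hdist hL6 V hβ hsize hlip (j := i) hi.le b
  have hA := B13AvgCorrRefineVariation.dist1_axialTower_quot_le V V' ht i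
  refine (B13AvgCorrRefineVariation.dist1_loopHol_avgTower_quot_le_of_forall (expMeanLogSU (n := n)) hcomm V V' i ha hC hA c r).trans
    (add_le_add le_rfl ?_)
  -- σ-L1 file 2 on the refined loop word, area ≤ c·X²
  refine (B13AvgCorrStokesVariationLoop.dist1_two_loopWord_le_of_bound V V' hs0 hs₁0 ht0 hcomm hs hs₁ ht _ (P.L ^ (i + 1)) c.dir _ r.2.1 r.2.2
    (B13AvgCorrKappa.natAbs_refined_off_le i r.1) (length_refined_loopWord_le i c.dir r)).trans ?_
  refine mul_le_mul_of_nonneg_right ?_ (by positivity)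
  have := area_le (d := (P.d : ℝ)) (X := ((P.L ^ (i + 1) : ℕ) : ℝ)) (h := ((P.L ^ i * ((P.L - 1) / 2) : ℕ) : ℝ))
    (Nat.cast_nonneg _) (Nat.cast_nonneg _) (Nat.cast_nonneg _) (refined_h_le i)
  simpa [Nat.cast_pow] using this

end Local

/-! ## §3 The step of the strong induction: the unit-shift letter at level `i` from the letters below `i`  -/

section Step

variable {P : Params} {n : Type*} [Fintype n] [DecidableEq n] [Nonempty n] {o : Type*} [Fintype o] [DecidableEq o]
  (ι : Matrix.specialUnitaryGroup n ℂ →* Matrix o o ℂ)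

/-- [folklore] **THE STEP OF THE STRONG INDUCTION**: from the window letters and the unit-shift letters with constant `κ₁ = kappaOne …` at every
level `j < i`, the unit-shift letter at level `i` with the SAME constant — §1's two lemmas ∘ PART 2a's `dist1_corrAcc_pair_le` ∘ PART 2a's `step_le` (after
normalising the powers of `L` to the atoms `L^i`, `L`, `L^(K−1−i)`). -/
theorem sigma_step (hι : ∀ g, ι g ∈ Matrix.unitaryGroup o ℂ) (hdist : ∀ g, ‖ι g - 1‖ = dist1 g)
    (hL6 : 6 * (P.d + 2) ≤ P.L) (V : GaugeField P 0 (Matrix.specialUnitaryGroup n ℂ)) {α β β₂ : ℝ} (hβ : 0 ≤ β) (hβ₂ : 0 ≤ β₂)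
    (hsize : ∀ b : PBond P 0, (P.L : ℝ) ^ P.K * dist1 (V b) ≤ α)
    (hlip : ∀ (x : Site P 0) (ν μ : Fin P.d), (P.L : ℝ) ^ P.K * ‖ι (V ⟨x.shift μ, ν⟩) - ι (V ⟨x, ν⟩)‖ ≤ β / (P.L : ℝ) ^ P.K)
    (hsec : ∀ (x : Site P 0) (μ ν ρ : Fin P.d), (P.L : ℝ) ^ P.K *
      ‖ι (V ⟨(x.shift ν).shift ρ, μ⟩) - ι (V ⟨x.shift ν, μ⟩) - ι (V ⟨x.shift ρ, μ⟩) + ι (V ⟨x, μ⟩)‖ ≤ β₂ / ((P.L : ℝ) ^ P.K) ^ 2)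
    {i : ℕ} (hi : i < P.K) (ν : Fin P.d)
    (hbelow : ∀ j < i, ∀ c' : PBond P (j + 1),
      dist1 (corr (expMeanLogSU (n := n)) (avgTower (expMeanLogSU (n := n)) V j) (c'.translate ((0 : Site P (j + 1)).shift ν))
        * (corr (expMeanLogSU (n := n)) (avgTower (expMeanLogSU (n := n)) V j) c')⁻¹)
          ≤ kappaOne P.d α β β₂ (deltaSU n) / ((P.L : ℝ) ^ (P.K - 1 - j)) ^ 3)
    (c : PBond P (i + 1)) :
    dist1 (corr (expMeanLogSU (n := n)) (avgTower (expMeanLogSU (n := n)) V i) (c.translate ((0 : Site P (i + 1)).shift ν))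
        * (corr (expMeanLogSU (n := n)) (avgTower (expMeanLogSU (n := n)) V i) c)⁻¹)
      ≤ kappaOne P.d α β β₂ (deltaSU n) / ((P.L : ℝ) ^ (P.K - 1 - i)) ^ 3 := by
  have hα0 : 0 ≤ α := le_trans (mul_nonneg (pow_nonneg (Nat.cast_nonneg _) _) (GaugeGroup.dist1_nonneg _)) (hsize ⟨default, ⟨0, P.hd⟩⟩)
  have hK₁ : 0 ≤ kappaOne P.d α β β₂ (deltaSU n) := kappaOne_nonneg (Nat.cast_nonneg _) hα0 hβ hβ₂ deltaSU_pos
  have hC := dist1_corrAcc_pair_le ι hι hdist hL6 V hβ hsize hlip hi ν hK₁ hbelow i le_rfl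
  have hq := fun r => dist1_loopHol_shift_quot_le_of_letters ι hι hdist hL6 V hβ hβ₂ hsize hlip hsec hi c ν hC r
  have h := dist1_corr_shift_quot_le_of_loopHol ι hι hdist hL6 V hβ hsize hlip hi c ((0 : Site P (i + 1)).shift ν) hq
  refine h.trans ?_
  push_cast
  -- normalise the powers of `L` to the atoms `L^i`, `L`, `ℓ = L^(K−1−i)`
  have eX : (P.L : ℝ) ^ P.K = (P.L : ℝ) ^ i * P.L * (P.L : ℝ) ^ (P.K - 1 - i) := by
    rw [← pow_succ, ← pow_add]; congr 1; omega
  have eKi : (P.L : ℝ) ^ (P.K - i) = P.L * (P.L : ℝ) ^ (P.K - 1 - i) := by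
    rw [← pow_succ']; congr 1; omega
  have e2K : (P.L : ℝ) ^ (2 * P.K) = ((P.L : ℝ) ^ P.K) ^ 2 := by rw [pow_mul']
  have ei1 : (P.L : ℝ) ^ (i + 1) = (P.L : ℝ) ^ i * P.L := pow_succ _ _
  rw [e2K, eX, eKi, ei1]
  have hL6' : (6 : ℝ) * ((P.d : ℝ) + 2) ≤ P.L := by exact_mod_cast hL6
  have hd' : (1 : ℝ) ≤ P.d := by exact_mod_cast P.hd
  have hL1 : (1 : ℝ) ≤ P.L := by linarith
  have hα : 0 ≤ α := le_trans (mul_nonneg (pow_nonneg (by linarith) _) (GaugeGroup.dist1_nonneg _)) (hsize ⟨default, ⟨0, P.hd⟩⟩)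
  exact step_le hL6' hd' (one_le_pow₀ hL1) (one_le_pow₀ hL1) (by positivity) (by positivity) (by positivity) hβ (by positivity)
    deltaSU_pos rfl

end Step

/-! ## §4 σ-END: the correction-VARIATION letter `κ₁` of the averaging tower of `expMeanLogSU` (strong induction on the step) -/

section End

variable {P : Params} {n : Type*} [Fintype n] [DecidableEq n] [Nonempty n] {o : Type*} [Fintype o] [DecidableEq o]
  (ι : Matrix.specialUnitaryGroup n ℂ →* Matrix o o ℂ)

/-- [folklore] **σ-END — THE ONE-STEP CORRECTION FACTORS OF BAŁABAN's (0.4) AVERAGE OF RECORD ARE LIPSCHITZ UNDER UNIT BLOCK SHIFTS AT SCALE `ℓ⁻³`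
ALONG THE AVERAGING TOWER OF A THREE-LETTER-REGULAR FINEST FIELD** (memo `t4/T4-EST-NE5-JAVG-SECOND.md` (C1); T4-DAG Q52 (2) «σ-END»).  For the printed
`SU(N)` exp-mean-log average, ANY unitary reading `ι` with `‖ι g − 1‖ = dist1 g`, ANY finest configuration `V` carrying the window letters — size `α`,
Lipschitz `β ≥ 0`, and the DISPLAYED (3.36)-shape second-difference letter `β₂ ≥ 0` (the body of W-28a's `SecondOrderWindow P ι V β₂`) — and
`6(d+2) ≤ L`, with NO smallness condition on `(α, β, β₂)`:
`∀ i < K, ∀ c ν, dist1 (corr ℰ U_i (c + e_ν) · (corr ℰ U_i c)⁻¹) ≤ κ₁∕(L^(K−1−i))³`, `κ₁ = kappaOne d α β β₂ δ_N` EXPLICIT and independent of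
`i`, `K`, `V`, `L` and the volume (`δ_N = deltaSU n` the guard radius of `expMeanLogSU`).  Strong induction on `i` over `sigma_step`: σ-L4's
threshold-free socket ∘ σ-L3's two-field END at the translate pair ∘ {σ-L1's Stokes for differences on the refined loop word with PART 1's letters,
κ-END's accumulated budgets, §2's accumulated-quotient induction fed by the letters below `i`} ∘ §0's arithmetic. -/
theorem dist1_corr_avgTower_shift_quot_le (hι : ∀ g, ι g ∈ Matrix.unitaryGroup o ℂ) (hdist : ∀ g, ‖ι g - 1‖ = dist1 g)
    (hL6 : 6 * (P.d + 2) ≤ P.L) (V : GaugeField P 0 (Matrix.specialUnitaryGroup n ℂ)) {α β β₂ : ℝ} (hβ : 0 ≤ β) (hβ₂ : 0 ≤ β₂)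
    (hsize : ∀ b : PBond P 0, (P.L : ℝ) ^ P.K * dist1 (V b) ≤ α)
    (hlip : ∀ (x : Site P 0) (ν μ : Fin P.d), (P.L : ℝ) ^ P.K * ‖ι (V ⟨x.shift μ, ν⟩) - ι (V ⟨x, ν⟩)‖ ≤ β / (P.L : ℝ) ^ P.K)
    (hsec : ∀ (x : Site P 0) (μ ν ρ : Fin P.d), (P.L : ℝ) ^ P.K *
      ‖ι (V ⟨(x.shift ν).shift ρ, μ⟩) - ι (V ⟨x.shift ν, μ⟩) - ι (V ⟨x.shift ρ, μ⟩) + ι (V ⟨x, μ⟩)‖ ≤ β₂ / ((P.L : ℝ) ^ P.K) ^ 2) :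
    ∀ i < P.K, ∀ (c : PBond P (i + 1)) (ν : Fin P.d),
      dist1 (corr (expMeanLogSU (n := n)) (avgTower (expMeanLogSU (n := n)) V i) (c.translate ((0 : Site P (i + 1)).shift ν))
          * (corr (expMeanLogSU (n := n)) (avgTower (expMeanLogSU (n := n)) V i) c)⁻¹)
        ≤ kappaOne P.d α β β₂ (deltaSU n) / ((P.L : ℝ) ^ (P.K - 1 - i)) ^ 3 := by
  intro i
  induction i using Nat.strong_induction_on with
  | _ i IH =>
    intro hi c ν
    exact sigma_step ι hι hdist hL6 V hβ hβ₂ hsize hlip hsec hi ν (fun j hj c' => IH j hj (lt_trans hj hi) c' ν) c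

/-- [folklore] **σ-END IN THE MATRIX-DIFFERENCE CURRENCY** of the memo's (C1) ∕ the owner's abstract half (`B13ReadingsAvgTowerSecond.dist_shift_of_step`'s
`hCC : ‖C′ − C‖ ≤ κ₁∕ℓ³`): `‖ι (corr ℰ U_i (c + e_ν)) − ι (corr ℰ U_i c)‖ ≤ κ₁∕(L^(K−1−i))³`. -/
theorem norm_corr_avgTower_shift_sub_le (hι : ∀ g, ι g ∈ Matrix.unitaryGroup o ℂ) (hdist : ∀ g, ‖ι g - 1‖ = dist1 g)
    (hL6 : 6 * (P.d + 2) ≤ P.L) (V : GaugeField P 0 (Matrix.specialUnitaryGroup n ℂ)) {α β β₂ : ℝ} (hβ : 0 ≤ β) (hβ₂ : 0 ≤ β₂)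
    (hsize : ∀ b : PBond P 0, (P.L : ℝ) ^ P.K * dist1 (V b) ≤ α)
    (hlip : ∀ (x : Site P 0) (ν μ : Fin P.d), (P.L : ℝ) ^ P.K * ‖ι (V ⟨x.shift μ, ν⟩) - ι (V ⟨x, ν⟩)‖ ≤ β / (P.L : ℝ) ^ P.K)
    (hsec : ∀ (x : Site P 0) (μ ν ρ : Fin P.d), (P.L : ℝ) ^ P.K *
      ‖ι (V ⟨(x.shift ν).shift ρ, μ⟩) - ι (V ⟨x.shift ν, μ⟩) - ι (V ⟨x.shift ρ, μ⟩) + ι (V ⟨x, μ⟩)‖ ≤ β₂ / ((P.L : ℝ) ^ P.K) ^ 2)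
    {i : ℕ} (hi : i < P.K) (c : PBond P (i + 1)) (ν : Fin P.d) :
    ‖ι (corr (expMeanLogSU (n := n)) (avgTower (expMeanLogSU (n := n)) V i) (c.translate ((0 : Site P (i + 1)).shift ν)))
        - ι (corr (expMeanLogSU (n := n)) (avgTower (expMeanLogSU (n := n)) V i) c)‖
      ≤ kappaOne P.d α β β₂ (deltaSU n) / ((P.L : ℝ) ^ (P.K - 1 - i)) ^ 3 := by
  rw [norm_map_sub_map ι hι hdist]
  exact dist1_corr_avgTower_shift_quot_le ι hι hdist hL6 V hβ hβ₂ hsize hlip hsec i hi c ν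

/-- [folklore] **σ-END IN THE k-INDEXED SCALED CURRENCY** of the substrate's displays (`i + 1 + k = K` names the step by the NE2 level of its coarse lattice;
W-28b's letters live in it): `‖ι (corr ℰ U_i (c + e_ν)) − ι (corr ℰ U_i c)‖·(lev L k)³ ≤ κ₁`. -/
theorem norm_corr_avgTower_shift_sub_scaled_le (hι : ∀ g, ι g ∈ Matrix.unitaryGroup o ℂ) (hdist : ∀ g, ‖ι g - 1‖ = dist1 g)
    (hL6 : 6 * (P.d + 2) ≤ P.L) (V : GaugeField P 0 (Matrix.specialUnitaryGroup n ℂ)) {α β β₂ : ℝ} (hβ : 0 ≤ β) (hβ₂ : 0 ≤ β₂)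
    (hsize : ∀ b : PBond P 0, (P.L : ℝ) ^ P.K * dist1 (V b) ≤ α)
    (hlip : ∀ (x : Site P 0) (ν μ : Fin P.d), (P.L : ℝ) ^ P.K * ‖ι (V ⟨x.shift μ, ν⟩) - ι (V ⟨x, ν⟩)‖ ≤ β / (P.L : ℝ) ^ P.K)
    (hsec : ∀ (x : Site P 0) (μ ν ρ : Fin P.d), (P.L : ℝ) ^ P.K *
      ‖ι (V ⟨(x.shift ν).shift ρ, μ⟩) - ι (V ⟨x.shift ν, μ⟩) - ι (V ⟨x.shift ρ, μ⟩) + ι (V ⟨x, μ⟩)‖ ≤ β₂ / ((P.L : ℝ) ^ P.K) ^ 2) :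
    ∀ (i k : ℕ), i + 1 + k = P.K → ∀ (c : PBond P (i + 1)) (ν : Fin P.d),
      ‖ι (corr (expMeanLogSU (n := n)) (avgTower (expMeanLogSU (n := n)) V i) (c.translate ((0 : Site P (i + 1)).shift ν)))
          - ι (corr (expMeanLogSU (n := n)) (avgTower (expMeanLogSU (n := n)) V i) c)‖ * ((lev P.L k : ℕ) : ℝ) ^ 3
        ≤ kappaOne P.d α β β₂ (deltaSU n) := by
  intro i k hik c ν
  have h := norm_corr_avgTower_shift_sub_le ι hι hdist hL6 V hβ hβ₂ hsize hlip hsec (i := i) (by omega) c ν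
  have hk : P.K - 1 - i = k := by omega
  have hℓ : (0 : ℝ) < ((lev P.L k : ℕ) : ℝ) ^ 3 := pow_pos (by exact_mod_cast one_le_lev' P.L k) 3
  rw [hk, ← cast_lev' P.L k, le_div_iff₀ hℓ] at h
  exact h

/-- [folklore] **σ-END IN THE SUBSTRATE's J-σ₁ DISPLAY SHAPE** (W-28c `SubstrateAvgTowerRegularityLetters.corr_shift_clause`'s binder `hκ₁`, substrate-typer (σ11)
`HOME/CLAIMS.log` l.25961 — token for token): the dist1-QUOTIENT of the correction factors at the shifted bond `⟨x + e_ν, μ⟩` vs `⟨x, μ⟩`, k-indexed and scaled: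
`j + 1 + k = K ⟹ dist1 (corr ℰ U_j ⟨x + e_ν, μ⟩ · (corr ℰ U_j ⟨x, μ⟩)⁻¹)·(lev L k)³ ≤ κ₁`.  ONE rewrite (`translate_zero_shift`) over the END. -/
theorem dist1_corr_avgTower_shift_quot_scaled_le (hι : ∀ g, ι g ∈ Matrix.unitaryGroup o ℂ) (hdist : ∀ g, ‖ι g - 1‖ = dist1 g)
    (hL6 : 6 * (P.d + 2) ≤ P.L) (V : GaugeField P 0 (Matrix.specialUnitaryGroup n ℂ)) {α β β₂ : ℝ} (hβ : 0 ≤ β) (hβ₂ : 0 ≤ β₂)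
    (hsize : ∀ b : PBond P 0, (P.L : ℝ) ^ P.K * dist1 (V b) ≤ α)
    (hlip : ∀ (x : Site P 0) (ν μ : Fin P.d), (P.L : ℝ) ^ P.K * ‖ι (V ⟨x.shift μ, ν⟩) - ι (V ⟨x, ν⟩)‖ ≤ β / (P.L : ℝ) ^ P.K)
    (hsec : ∀ (x : Site P 0) (μ ν ρ : Fin P.d), (P.L : ℝ) ^ P.K *
      ‖ι (V ⟨(x.shift ν).shift ρ, μ⟩) - ι (V ⟨x.shift ν, μ⟩) - ι (V ⟨x.shift ρ, μ⟩) + ι (V ⟨x, μ⟩)‖ ≤ β₂ / ((P.L : ℝ) ^ P.K) ^ 2) :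
    ∀ (j k : ℕ), j + 1 + k = P.K → ∀ (x : Site P (j + 1)) (μ ν : Fin P.d),
      dist1 (corr (expMeanLogSU (n := n)) (avgTower (expMeanLogSU (n := n)) V j) ⟨x.shift ν, μ⟩
          * (corr (expMeanLogSU (n := n)) (avgTower (expMeanLogSU (n := n)) V j) ⟨x, μ⟩)⁻¹) * ((lev P.L k : ℕ) : ℝ) ^ 3
        ≤ kappaOne P.d α β β₂ (deltaSU n) := by
  intro j k hjk x μ ν
  have h := dist1_corr_avgTower_shift_quot_le ι hι hdist hL6 V hβ hβ₂ hsize hlip hsec j (by omega) ⟨x, μ⟩ ν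
  have hk : P.K - 1 - j = k := by omega
  have hℓ : (0 : ℝ) < ((lev P.L k : ℕ) : ℝ) ^ 3 := pow_pos (by exact_mod_cast one_le_lev' P.L k) 3
  rw [translate_zero_shift, hk, ← cast_lev' P.L k, le_div_iff₀ hℓ] at h
  exact h

end End

end Summit.QuantumFields.BalabanUV.T4Continuum.B13AvgCorrKappaOne

end
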